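import Literature.NumberTheory.LFunctions.ChebotarevDensity
import Literature.NumberTheory.LFunctions.DirichletDensityLemmas
import HarnessLib

/-!
# A squeezing principle for Dirichlet densities of a finite partition of the primes

Topic `Literature/NumberTheory/LFunctions`; namespace `Literature.NumberTheory.LFunctions`.
Everything in this file is PROVED (theorems only).

Let the rational primes outside a finite set `T` be partitioned into finitely many classes
`X_i` (`i ∈ ι`), and let `d_i` be real numbers with `Σ_i d_i = 1`.  Suppose that each class is
known to be *at least* as dense as `d_i` in the following approximate sense: for every `ε > 0`
there is a set of primes `Y ⊆ X_i` having a Dirichlet density `≥ d_i - ε`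
(`Literature.NumberTheory.LFunctions.HasDirichletDensity`, the `log (1/(s-1))`-limit form of
Neukirch VII (13.1) / Serre, *Cours d'arithmétique* VI.4.1).  Then **every class `X_i` has
Dirichlet density exactly `d_i`** (`hasDirichletDensity_of_forall_exists_subset`): the lower
bounds give `liminf F_{X_i}/log ≥ d_i`, and since `Σ_i F_{X_i}(s) / log (1/(s-1)) → 1` (all but
finitely many primes are covered, each once) the lower bounds of the other classes give
`limsup F_{X_j}/log ≤ 1 - Σ_{i ≠ j} d_i = d_j`.

This is the book-keeping step of Chebotarev's original (class-field-theory-free) proof of his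
density theorem (N. Tschebotareff, *Die Bestimmung der Dichtigkeit einer Menge von Primzahlen,
welche zu einer gegebenen Substitutionsklasse gehören*, Math. Ann. 95 (1926); Stevenhagen–Lenstra,
*Chebotarëv and his density theorem*, 1996, "Chebotarëv's proof"): there `X_C` is the set of
primes with Frobenius class `C` in `Gal(L/ℚ)`, `d_C = #C/#G`, and the subsets `Y` are supplied
by "Chebotarëv's trick" of adjoining `m`-th roots of unity, with densities
`(#C/#G) · (1 - ε_m)`, `ε_m → 0`.  Only the limit (not a convergent remainder) comes out, which is
why Chebotarev's theorem at finite level is recorded in Neukirch's notion of density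
(`ChebotarevDensityNumberField.lean`).

## References

* P. Stevenhagen, H. W. Lenstra, *Chebotarëv and his density theorem*, Math. Intelligencer 18
  (1996), no. 2, 26–37. [StevenhagenLenstra1996]
* J. Neukirch, *Algebraic Number Theory*, Springer 1999, VII (13.1). [NeukirchANT1999]
-/

noncomputable section

open Filter
open scoped Topology Classical

namespace Literature.NumberTheory.LFunctions

namespace PrimeSum

variable {ι : Type*} (X : ι → Set ℕ) [∀ i, ∀ p : ℕ, Decidable (p.Prime ∧ p ∈ X i)]
  (U : Set ℕ) [∀ p : ℕ, Decidable (p.Prime ∧ p ∈ U)]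

/-- For pairwise prime-disjoint sets `X_i`, `i ∈ S`, the prime sum of their union `U` is the sum
of the prime sums: `F_U(s) = Σ_i F_{X_i}(s)` (`s > 1`). [folklore] -/
theorem tsum_eq_sum_of_disjoint (S : Finset ι) (hU : ∀ p : ℕ, p ∈ U ↔ ∃ i ∈ S, p ∈ X i)
    (hdisj : ∀ i ∈ S, ∀ j ∈ S, i ≠ j → ∀ p : ℕ, p.Prime → p ∈ X i → p ∉ X j) {s : ℝ} (hs : 1 < s) :
    (∑' p : ℕ, if p.Prime ∧ p ∈ U then (p : ℝ) ^ (-s) else 0) =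
      ∑ i ∈ S, ∑' p : ℕ, if p.Prime ∧ p ∈ X i then (p : ℝ) ^ (-s) else 0 := by
  rw [← Summable.tsum_finsetSum (fun i _ ↦ PrimeSum.summable (X i) hs)]
  refine tsum_congr fun p ↦ ?_
  by_cases hp : p.Prime
  · by_cases hpU : ∃ i ∈ S, p ∈ X i
    · obtain ⟨i, hiS, hpi⟩ := hpU
      rw [if_pos ⟨hp, (hU p).mpr ⟨i, hiS, hpi⟩⟩, ← Finset.add_sum_erase S _ hiS, if_pos ⟨hp, hpi⟩]
      rw [Finset.sum_eq_zero fun j hj ↦ ?_, add_zero]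
      obtain ⟨hji, hjS⟩ := Finset.mem_erase.mp hj
      rw [if_neg fun h ↦ hdisj i hiS j hjS (Ne.symm hji) p hp hpi h.2]
    · rw [if_neg fun h ↦ hpU ((hU p).mp h.2)]
      symm
      refine Finset.sum_eq_zero fun j hj ↦ ?_
      rw [if_neg fun h ↦ hpU ⟨j, hj, h.2⟩]
  · rw [if_neg fun h ↦ hp h.1]
    symm
    exact Finset.sum_eq_zero fun j _ ↦ by rw [if_neg fun h ↦ hp h.1]

end PrimeSum

section Squeeze

variable {ι : Type*} [Fintype ι] {X : ι → Set ℕ} {d : ι → ℝ} {T : Set ℕ}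

/-- **Squeezing principle for a finite partition of the primes.**  Let the primes outside the
finite set `T` be covered by the pairwise prime-disjoint sets `X_i` (`i ∈ ι`, finite), and let
`Σ_i d_i = 1`.  If for every `i` and every `ε > 0` some set of primes `Y ⊆ X_i` has a Dirichlet
density `d' ≥ d_i - ε`, then every `X_i` has Dirichlet density `d_i` (lower bounds:
`F_Y ≤ F_{X_i}`; upper bound for `X_j`: `Σ_i F_{X_i} / log (1/(s-1)) → 1` and the lower bounds of
the `X_i`, `i ≠ j`).  This is the final step of Chebotarev's own proof of his density theorem
(Stevenhagen–Lenstra 1996, "Chebotarëv's proof"). [cite: StevenhagenLenstra1996, §"Chebotarëv's proof"] -/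
theorem hasDirichletDensity_of_forall_exists_subset
    (hdisj : ∀ i j : ι, i ≠ j → ∀ p : ℕ, p.Prime → p ∈ X i → p ∉ X j)
    (hT : T.Finite) (hcover : ∀ p : ℕ, p.Prime → p ∉ T → ∃ i, p ∈ X i)
    (hsum : ∑ i, d i = 1)
    (hlow : ∀ i : ι, ∀ ε : ℝ, 0 < ε → ∃ Y : Set ℕ, (∀ p : ℕ, p.Prime → p ∈ Y → p ∈ X i) ∧
      ∃ d' : ℝ, d i - ε ≤ d' ∧ HasDirichletDensity Y d') (j : ι) :
    HasDirichletDensity (X j) (d j) := by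
  -- notation: `F Z s`, `ℓ s`, `g i s = F (X i) s / ℓ s`
  set F : Set ℕ → ℝ → ℝ := fun Z s ↦ ∑' p : ℕ, if p.Prime ∧ p ∈ Z then (p : ℝ) ^ (-s) else 0
    with hF
  set ℓ : ℝ → ℝ := fun s ↦ Real.log (1 / (s - 1)) with hℓ
  set g : ι → ℝ → ℝ := fun i s ↦ F (X i) s / ℓ s with hg
  -- Step A: eventual lower bounds `d i - ε < g i s`
  have hA : ∀ i : ι, ∀ ε : ℝ, 0 < ε → ∀ᶠ s : ℝ in 𝓝[>] (1 : ℝ), d i - ε < g i s := by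
    intro i ε hε
    obtain ⟨Y, hYX, d', hd', hY⟩ := hlow i (ε / 2) (by linarith)
    rw [hasDirichletDensity_iff] at hY
    have h1 : ∀ᶠ s : ℝ in 𝓝[>] (1 : ℝ), d' - ε / 2 < F Y s / ℓ s :=
      hY.eventually (lt_mem_nhds (by linarith))
    filter_upwards [h1, PrimeSum.eventually_log_pos, PrimeSum.eventually_one_lt] with s h1 hlog hs
    have hmono : F Y s ≤ F (X i) s := PrimeSum.mono hYX hs
    have : F Y s / ℓ s ≤ g i s := div_le_div_of_nonneg_right hmono hlog.le
    linarith
  -- Step B: `Σ_i g i s → 1`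
  have hB : Tendsto (fun s : ℝ ↦ ∑ i, g i s) (𝓝[>] (1 : ℝ)) (𝓝 1) := by
    -- the union, as an opaque set (so that all `if`s use the same decidability instances)
    obtain ⟨U, hU⟩ : ∃ U : Set ℕ, ∀ p : ℕ, p ∈ U ↔ ∃ i ∈ (Finset.univ : Finset ι), p ∈ X i :=
      ⟨{p | ∃ i, p ∈ X i}, fun p ↦ by simp⟩
    have hUeq : ∀ s : ℝ, 1 < s → F U s = ∑ i, F (X i) s := fun s hs ↦
      PrimeSum.tsum_eq_sum_of_disjoint X U Finset.univ hU (fun i _ j _ hij ↦ hdisj i j hij) hs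
    set FU : ℝ → ℝ := fun s ↦
      ∑' p : ℕ, if p.Prime ∧ p ∈ (Set.univ : Set ℕ) then (p : ℝ) ^ (-s) else 0 with hFU
    -- `F_univ - F_T ≤ F_U ≤ F_univ`
    have hUle : ∀ s : ℝ, 1 < s → F U s ≤ FU s := fun s hs ↦
      PrimeSum.mono (X := U) (Y := Set.univ) (fun p _ _ ↦ Set.mem_univ p) hs
    have hleU : ∀ s : ℝ, 1 < s → FU s ≤ F U s + F T s := fun s hs ↦
      PrimeSum.le_add (Z := Set.univ) (X := U) (Y := T) (fun p hp _ ↦ by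
        by_cases hpT : p ∈ T
        · exact Or.inr hpT
        · obtain ⟨i, hi⟩ := hcover p hp hpT
          exact Or.inl ((hU p).mpr ⟨i, Finset.mem_univ i, hi⟩)) hs
    have huniv : Tendsto (fun s : ℝ ↦ FU s / ℓ s) (𝓝[>] (1 : ℝ)) (𝓝 1) :=
      PrimeSum.tendsto_univ_div_log
    have hT0 : Tendsto (fun s : ℝ ↦ F T s / ℓ s) (𝓝[>] (1 : ℝ)) (𝓝 0) :=
      PrimeSum.tendsto_div_log_zero_of_finite T hT
    have hlow' : Tendsto (fun s : ℝ ↦ FU s / ℓ s - F T s / ℓ s) (𝓝[>] (1 : ℝ)) (𝓝 1) := by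
      have := huniv.sub hT0
      rwa [sub_zero] at this
    have hUlim : Tendsto (fun s : ℝ ↦ F U s / ℓ s) (𝓝[>] (1 : ℝ)) (𝓝 1) := by
      refine tendsto_of_tendsto_of_tendsto_of_le_of_le' hlow' huniv ?_ ?_
      · filter_upwards [PrimeSum.eventually_log_pos, PrimeSum.eventually_one_lt] with s hlog hs
        rw [← sub_div]
        exact div_le_div_of_nonneg_right (by linarith [hleU s hs]) hlog.le
      · filter_upwards [PrimeSum.eventually_log_pos, PrimeSum.eventually_one_lt] with s hlog hs
        exact div_le_div_of_nonneg_right (hUle s hs) hlog.le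
    refine hUlim.congr' ?_
    filter_upwards [PrimeSum.eventually_one_lt] with s hs
    rw [hUeq s hs, Finset.sum_div]
  -- Step C: eventual upper bounds `g j s < d j + ε`
  have hC : ∀ ε : ℝ, 0 < ε → ∀ᶠ s : ℝ in 𝓝[>] (1 : ℝ), g j s < d j + ε := by
    intro ε hε
    set δ : ℝ := ε / (2 * ((Fintype.card ι : ℝ) + 1)) with hδ
    have hcardpos : (0 : ℝ) < (Fintype.card ι : ℝ) + 1 := by positivity
    have hδpos : 0 < δ := by positivity
    have hAll : ∀ᶠ s : ℝ in 𝓝[>] (1 : ℝ), ∀ i, d i - δ < g i s :=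
      Filter.eventually_all.mpr fun i ↦ hA i δ hδpos
    have hBε : ∀ᶠ s : ℝ in 𝓝[>] (1 : ℝ), ∑ i, g i s < 1 + δ :=
      hB.eventually (gt_mem_nhds (by linarith))
    filter_upwards [hAll, hBε] with s hAll hBε
    have hsplit_g : ∑ i, g i s = g j s + ∑ i ∈ Finset.univ.erase j, g i s :=
      (Finset.add_sum_erase _ _ (Finset.mem_univ j)).symm
    have hsplit_d : ∑ i, d i = d j + ∑ i ∈ Finset.univ.erase j, d i :=
      (Finset.add_sum_erase _ _ (Finset.mem_univ j)).symm
    have hrest : ∑ i ∈ Finset.univ.erase j, (d i - δ) ≤ ∑ i ∈ Finset.univ.erase j, g i s :=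
      Finset.sum_le_sum fun i _ ↦ (hAll i).le
    rw [Finset.sum_sub_distrib, Finset.sum_const, nsmul_eq_mul] at hrest
    have hcard : ((Finset.univ.erase j).card : ℝ) ≤ (Fintype.card ι : ℝ) := by
      exact_mod_cast (Finset.card_erase_le).trans (Finset.card_univ (α := ι)).le
    have hδε : ((Fintype.card ι : ℝ) + 1) * δ = ε / 2 := by
      rw [hδ]
      field_simp
    nlinarith [hδpos, hcard, hrest, hBε, hsplit_g, hsplit_d, hsum, hδε]
  -- Step D: conclude by the order characterisation of the limit
  rw [hasDirichletDensity_iff]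
  change Tendsto (g j) (𝓝[>] (1 : ℝ)) (𝓝 (d j))
  refine tendsto_order.2 ⟨fun a ha ↦ ?_, fun b hb ↦ ?_⟩
  · have := hA j (d j - a) (by linarith)
    filter_upwards [this] with s hs
    linarith
  · have := hC (b - d j) (by linarith)
    filter_upwards [this] with s hs
    linarith

end Squeeze

end Literature.NumberTheory.LFunctions
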